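import Summits.ResolutionOfSingularities.ResolutionOfSingularities.Theorems.HilbertSamuelEliminationCampaignW42ConeBaseChange
import Summits.ResolutionOfSingularities.ResolutionOfSingularities.Theorems.HilbertSamuelEliminationCampaignW42RidgeConeBlowup
import Literature.RingTheory.Length.LengthEqFinrank
import HarnessLib

/-!
# [OURS · L1 W4.2] Ridge confinement at non-rational closed points of a cone, part III: the dictionary
# `T[Z]/θ(𝔮) ≅ κ[Y]/Iκ[Y]` between the twisted fibre of the frame and the base-changed cone (campaign s42,
# cell res-hironaka; informal crux `RidgeConfinement`, stmt-ResolutionOfSingularities-17845; `--supports`)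

HONEST FRAMING. OURS (slot W4.2, prover res-L1-s42-pv-1, gen 2): sequel of `…CampaignW42ConeFrame.lean` and
`…CampaignW42ConeBaseChange.lean`. Data: a surjection `π : K[X] ↠ T` with kernel `I` (`T = K[X]/I`), a
surjection `ρ : T ↠ κ` onto a field extension `κ ⊇ K` with `ker(ρ ∘ π) = 𝔮` (a closed point `𝔮 ⊇ I` of the cone
with residue field `κ`, possibly inseparable over `K`), the tautological point `w = (ρπX_i)_i ∈ C(κ)`,
`θ : s ↦ s(Y + Z) mod I` (`taylorY`, then `map π`) and `D = θ(𝔮)T[Z]`.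
* `exists_ringEquiv_quotient_map_taylor` — **`T[Z]/D ≅ κ[Y]/Iκ[Y]`**, `Z_i ↦ w_i - Y_i`, `π(s) ↦ s(Y)` (inverse:
  `κ ∋ ρπ(u) ↦ θ(u)`, `Y_i ↦ π(X_i)`); `nonempty_ringEquiv_quotient_map_taylor_sup_pow` —
  **`T[Z]/(D + (Z)^k) ≅ κ[Y]/(Iκ[Y] + 𝔪_w^k)`** (`(Z) ↦ 𝔪_w = (Y - w)`);
* `isLocalRing_quotient_sup_ker_eval_pow`, `exists_sub_algebraMap_mem_quotient_sup_ker_eval_pow` — the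
  quotients `κ[Y]/(J + 𝔪_v^{d+1})` (`J ⊆ 𝔪_v`) are local with residue field `κ`;
* **`length_quotient_frame_eq_finrank`** — for `L` a localization of `T[Z]` at `𝔑 = π(𝔮)T[Z] + (Z)`:
  `ℓ_L(L/(D + (Z)^{d+1})L) = dim_κ κ[Y]/(Iκ[Y] + 𝔪_w^{d+1})` (`= H⁽¹⁾(𝒪_{C_κ,w})(d)`), turning Hironaka's
  base-change bound (`length_quotient_pow_frame_le_sum`) into jet codimensions of `C_κ` at `w` (part IV).

Classical mathematics (the computation behind CJS (3.6) / Lemma 2.27 and Hironaka's base change [H4]);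
NOTHING here is a statement of H. Hironaka's manuscript [Hironaka2017]. AI review is weaker than expert review.
References (orientation only): V. Cossart, U. Jannsen, S. Saito, LNM 2270 (2020), (3.6), proof of Thm. 3.10
(p. 47); J. Giraud, Ann. Sci. ÉNS 8 (1975) §1.5; W. Fulton, Intersection Theory, App. A.1.
-/

noncomputable section

-- single-conjunct summit: the doubled namespace component `ResolutionOfSingularities` is mandated
set_option linter.dupNamespace false

open MvPolynomial Module IsLocalRing
open Literature.RingTheory.HilbertSamuel
open Literature.AlgebraicGeometry.Resolution

namespace Summit.ResolutionOfSingularities.ResolutionOfSingularities.Theorems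

namespace CampaignW42

universe u

variable {K : Type u} [Field K] {n : ℕ} {T : Type u} [CommRing T] (π : MvPolynomial (Fin n) K →+* T)
  {κ : Type u} [Field κ] [Algebra K κ] (ρ : T →+* κ)

section Dictionary

variable {I 𝔮 : Ideal (MvPolynomial (Fin n) K)} (hπ : Function.Surjective π) (hkerπ : RingHom.ker π = I)
  (hρ : Function.Surjective ρ) (hkerρ : RingHom.ker (ρ.comp π) = 𝔮)
  (hρC : ∀ c : K, ρ (π (C c)) = algebraMap K κ c)

include hρC in
/-- The tautological point: `s(w) = ρ(π(s))` for `w = (ρπX_i)_i`. [folklore] -/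
theorem aeval_frame_point_eq (s : MvPolynomial (Fin n) K) :
    aeval (fun i => ρ (π (X i))) s = ρ (π s) := by
  have h : ((aeval fun i => ρ (π (X i))) : MvPolynomial (Fin n) K →ₐ[K] κ).toRingHom = ρ.comp π :=
    MvPolynomial.ringHom_ext
      (fun c => by rw [AlgHom.toRingHom_eq_coe, RingHom.coe_coe, aeval_C, RingHom.comp_apply, hρC])
      (fun i => by rw [AlgHom.toRingHom_eq_coe, RingHom.coe_coe, aeval_X, RingHom.comp_apply])
  exact RingHom.congr_fun h s

include hρC in
/-- `s_κ(w) = ρ(π(s))` for the base-changed polynomial `s_κ ∈ κ[Y]`. [folklore] -/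
theorem eval_map_frame_point_eq (s : MvPolynomial (Fin n) K) :
    eval (fun i => ρ (π (X i))) (MvPolynomial.map (algebraMap K κ) s) = ρ (π s) := by
  rw [eval_map, ← aeval_frame_point_eq π ρ hρC s, aeval_def]

include hkerπ hρC in
/-- `w ∈ C(κ)`: `Iκ[Y] ⊆ 𝔪_w`. [folklore] -/
theorem coneIdeal_le_ker_eval_frame_point :
    coneIdeal κ I ≤ RingHom.ker (eval fun i => ρ (π (X i))) := by
  rw [coneIdeal, Ideal.map_le_iff_le_comap]
  intro f hf
  rw [Ideal.mem_comap, RingHom.mem_ker, eval_map_frame_point_eq π ρ hρC f]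
  rw [show π f = 0 by rw [← RingHom.mem_ker, hkerπ]; exact hf, map_zero]

include hπ hkerπ hρ hkerρ hρC in
/-- **The dictionary `T[Z]/θ(𝔮)T[Z] ≅ κ[Y]/Iκ[Y]`**, `Z_i ↦ w_i - Y_i`, `π(s) ↦ s_κ(Y)`: the fibre of the frame
`T[Z]` over the twisted copy `θ(𝔮)` of the closed point `𝔮` is the coordinate ring of the base-changed cone
`C_κ`, in coordinates centred at its rational point `w` (`U = X + Z`, `κ = K[U]/𝔮(U)`, `Y = w - Z`; uses that
`I` is generated over `K`). [cite: CossartJannsenSaito2020, proof of Thm. 3.10 (p. 47)] -/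
theorem exists_ringEquiv_quotient_map_taylor :
    ∃ e : (MvPolynomial (Fin n) T ⧸ 𝔮.map ((MvPolynomial.map π).comp
        (taylorY K n : MvPolynomial (Fin n) K →+* MvPolynomial (Fin n) (MvPolynomial (Fin n) K)))) ≃+*
        (MvPolynomial (Fin n) κ ⧸ coneIdeal κ I),
      (∀ i, e (Ideal.Quotient.mk _ (X i)) = Ideal.Quotient.mk _ (C (ρ (π (X i))) - X i)) ∧
      ∀ s : MvPolynomial (Fin n) K, e (Ideal.Quotient.mk _ (C (π s))) =
        Ideal.Quotient.mk _ (MvPolynomial.map (algebraMap K κ) s) := by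
  set θ : MvPolynomial (Fin n) K →+* MvPolynomial (Fin n) T := (MvPolynomial.map π).comp
      (taylorY K n : MvPolynomial (Fin n) K →+* MvPolynomial (Fin n) (MvPolynomial (Fin n) K)) with hθ
  set D : Ideal (MvPolynomial (Fin n) T) := 𝔮.map θ with hD
  set I' : Ideal (MvPolynomial (Fin n) κ) := coneIdeal κ I with hI'
  set w : Fin n → κ := fun i => ρ (π (X i)) with hw
  have hwi : ∀ i, w i = ρ (π (X i)) := fun i => rfl
  have hθC : ∀ c : K, θ (C c) = C (π (C c)) := fun c => by
    simp only [hθ, RingHom.comp_apply, AlgHom.coe_toRingHom, taylorY_C, map_C]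
  have hθX : ∀ i, θ (X i) = C (π (X i)) + X i := fun i => by
    simp only [hθ, RingHom.comp_apply, AlgHom.coe_toRingHom, taylorY_X, map_add, map_C, map_X]
  have hρπ : Function.Surjective (ρ.comp π) := hρ.comp hπ
  let g₀ : MvPolynomial (Fin n) K →+* MvPolynomial (Fin n) κ ⧸ I' :=
    (Ideal.Quotient.mk I').comp (MvPolynomial.map (algebraMap K κ))
  have hg₀ : RingHom.ker π ≤ RingHom.ker g₀ := fun f hf => by
    rw [RingHom.mem_ker, RingHom.comp_apply, Ideal.Quotient.eq_zero_iff_mem]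
    exact map_mem_coneIdeal κ (hkerπ ▸ hf :)
  let c₀ : T →+* MvPolynomial (Fin n) κ ⧸ I' := π.liftOfSurjective hπ ⟨g₀, hg₀⟩
  have hc₀ : ∀ s, c₀ (π s) = Ideal.Quotient.mk I' (MvPolynomial.map (algebraMap K κ) s) :=
    fun s => π.liftOfSurjective_comp_apply hπ ⟨g₀, hg₀⟩ s
  let Ψ : MvPolynomial (Fin n) T →+* MvPolynomial (Fin n) κ ⧸ I' :=
    eval₂Hom c₀ fun i => Ideal.Quotient.mk I' (C (w i) - X i)
  have hΨC : ∀ t, Ψ (C t) = c₀ t := fun t => eval₂Hom_C _ _ t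
  have hΨX : ∀ i, Ψ (X i) = Ideal.Quotient.mk I' (C (w i) - X i) := fun i => eval₂Hom_X' _ _ i
  have hΨθ : Ψ.comp θ = ((Ideal.Quotient.mk I').comp C).comp (ρ.comp π) := by
    refine MvPolynomial.ringHom_ext (fun c => ?_) (fun i => ?_)
    · rw [RingHom.comp_apply, hθC, hΨC, hc₀, map_C, RingHom.comp_apply, RingHom.comp_apply,
        RingHom.comp_apply, hρC]
    · rw [RingHom.comp_apply, hθX, map_add, hΨC, hΨX, hc₀, map_X, ← map_add, add_sub_cancel,
        RingHom.comp_apply, RingHom.comp_apply, RingHom.comp_apply]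
  have hΨθ' : ∀ s, Ψ (θ s) = Ideal.Quotient.mk I' (C (ρ (π s))) := fun s => by
    have := RingHom.congr_fun hΨθ s
    simpa only [RingHom.comp_apply] using this
  have hDΨ' : D ≤ RingHom.ker Ψ := by
    rw [hD, Ideal.map_le_iff_le_comap]
    intro s hs
    rw [Ideal.mem_comap, RingHom.mem_ker, hΨθ' s]
    have : ρ (π s) = 0 := by rw [← RingHom.comp_apply, ← RingHom.mem_ker, hkerρ]; exact hs
    rw [this, map_zero, map_zero]
  have hDΨ : ∀ a ∈ D, Ψ a = 0 := fun a ha => hDΨ' ha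
  let Ψbar : (MvPolynomial (Fin n) T ⧸ D) →+* MvPolynomial (Fin n) κ ⧸ I' :=
    Ideal.Quotient.lift D Ψ hDΨ
  have hΨbar : ∀ r, Ψbar (Ideal.Quotient.mk D r) = Ψ r := fun r => Ideal.Quotient.lift_mk D Ψ hDΨ
  let g₁ : MvPolynomial (Fin n) K →+* MvPolynomial (Fin n) T ⧸ D := (Ideal.Quotient.mk D).comp θ
  have hg₁ : RingHom.ker (ρ.comp π) ≤ RingHom.ker g₁ := fun s hs => by
    rw [RingHom.mem_ker, RingHom.comp_apply, Ideal.Quotient.eq_zero_iff_mem, hD]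
    exact Ideal.mem_map_of_mem _ (hkerρ ▸ hs :)
  let d₀ : κ →+* MvPolynomial (Fin n) T ⧸ D := (ρ.comp π).liftOfSurjective hρπ ⟨g₁, hg₁⟩
  have hd₀ : ∀ s, d₀ (ρ (π s)) = Ideal.Quotient.mk D (θ s) := fun s => by
    have := (ρ.comp π).liftOfSurjective_comp_apply hρπ ⟨g₁, hg₁⟩ s
    rwa [RingHom.comp_apply] at this
  let Ψ'₀ : MvPolynomial (Fin n) κ →+* MvPolynomial (Fin n) T ⧸ D :=
    eval₂Hom d₀ fun i => Ideal.Quotient.mk D (C (π (X i)))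
  have hΨ'₀map : Ψ'₀.comp (MvPolynomial.map (algebraMap K κ)) =
      ((Ideal.Quotient.mk D).comp C).comp π := by
    refine MvPolynomial.ringHom_ext (fun c => ?_) (fun i => ?_)
    · rw [RingHom.comp_apply, map_C, ← hρC, eval₂Hom_C, hd₀, hθC, RingHom.comp_apply,
        RingHom.comp_apply]
    · rw [RingHom.comp_apply, map_X, eval₂Hom_X', RingHom.comp_apply, RingHom.comp_apply]
  have hI'Ψ'₀' : I' ≤ RingHom.ker Ψ'₀ := by
    rw [hI', coneIdeal, Ideal.map_le_iff_le_comap]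
    intro f hf
    rw [Ideal.mem_comap, RingHom.mem_ker, ← RingHom.comp_apply, hΨ'₀map, RingHom.comp_apply,
      RingHom.comp_apply, show π f = 0 by rw [← RingHom.mem_ker, hkerπ]; exact hf, map_zero, map_zero]
  have hI'Ψ'₀ : ∀ a ∈ I', Ψ'₀ a = 0 := fun a ha => hI'Ψ'₀' ha
  let Ψ' : (MvPolynomial (Fin n) κ ⧸ I') →+* MvPolynomial (Fin n) T ⧸ D :=
    Ideal.Quotient.lift I' Ψ'₀ hI'Ψ'₀
  have hΨ' : ∀ y, Ψ' (Ideal.Quotient.mk I' y) = Ψ'₀ y := fun y => Ideal.Quotient.lift_mk I' Ψ'₀ hI'Ψ'₀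
  have h₁ : Ψbar.comp Ψ' = RingHom.id _ := by
    refine Ideal.Quotient.ringHom_ext (MvPolynomial.ringHom_ext (fun a => ?_) (fun i => ?_))
    · obtain ⟨s, rfl⟩ := hρπ a
      simp only [RingHom.comp_apply, RingHom.id_apply]
      rw [hΨ', eval₂Hom_C, hd₀, hΨbar, hΨθ']
    · simp only [RingHom.comp_apply, RingHom.id_apply]
      rw [hΨ', eval₂Hom_X', hΨbar, hΨC, hc₀, map_X]
  have h₂ : Ψ'.comp Ψbar = RingHom.id _ := by
    refine Ideal.Quotient.ringHom_ext (MvPolynomial.ringHom_ext (fun t => ?_) (fun i => ?_))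
    · obtain ⟨s, rfl⟩ := hπ t
      have hs : Ψ'₀ (MvPolynomial.map (algebraMap K κ) s) = Ideal.Quotient.mk D (C (π s)) := by
        have := RingHom.congr_fun hΨ'₀map s
        simpa only [RingHom.comp_apply] using this
      simp only [RingHom.comp_apply, RingHom.id_apply]
      rw [hΨbar, hΨC, hc₀, hΨ', hs]
    · simp only [RingHom.comp_apply, RingHom.id_apply]
      rw [hΨbar, hΨX, hΨ', map_sub, eval₂Hom_C, eval₂Hom_X', hwi, hd₀, hθX, ← map_sub,
        add_sub_cancel_left]
  refine ⟨RingEquiv.ofRingHom Ψbar Ψ' h₁ h₂, fun i => ?_, fun s => ?_⟩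
  · rw [RingEquiv.ofRingHom_apply, hΨbar, hΨX]
  · rw [RingEquiv.ofRingHom_apply, hΨbar, hΨC, hc₀]

/-- Spans of a family and of its negatives agree. [folklore] -/
theorem span_range_neg_eq {R : Type*} [CommRing R] {ι : Type*} (f : ι → R) :
    Ideal.span (Set.range fun i => -f i) = Ideal.span (Set.range f) := by
  refine le_antisymm (Ideal.span_le.mpr ?_) (Ideal.span_le.mpr ?_)
  · rintro _ ⟨i, rfl⟩
    exact Submodule.neg_mem _ (Ideal.subset_span ⟨i, rfl⟩)
  · rintro _ ⟨i, rfl⟩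
    have h := Submodule.neg_mem _ (Ideal.subset_span ⟨i, rfl⟩ : -f i ∈ Ideal.span (Set.range fun i => -f i))
    rwa [neg_neg] at h

include hπ hkerπ hρ hkerρ hρC in
/-- **`T[Z]/(θ(𝔮)T[Z] + (Z)^k) ≅ κ[Y]/(Iκ[Y] + 𝔪_w^k)`** for every `k`: under the dictionary the ideal `(Z)` of
the frame corresponds to the ideal `𝔪_w = (Y - w)` of the rational point `w ∈ C_κ(κ)`.
[cite: CossartJannsenSaito2020, proof of Thm. 3.10 (p. 47)] -/
theorem nonempty_ringEquiv_quotient_map_taylor_sup_pow (k : ℕ) :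
    Nonempty ((MvPolynomial (Fin n) T ⧸ (𝔮.map ((MvPolynomial.map π).comp
        (taylorY K n : MvPolynomial (Fin n) K →+* MvPolynomial (Fin n) (MvPolynomial (Fin n) K))) ⊔
        idealOfVars (Fin n) T ^ k)) ≃+*
      (MvPolynomial (Fin n) κ ⧸ (coneIdeal κ I ⊔ RingHom.ker (eval fun i => ρ (π (X i))) ^ k))) := by
  set θ : MvPolynomial (Fin n) K →+* MvPolynomial (Fin n) T := (MvPolynomial.map π).comp
      (taylorY K n : MvPolynomial (Fin n) K →+* MvPolynomial (Fin n) (MvPolynomial (Fin n) K)) with hθ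
  set D : Ideal (MvPolynomial (Fin n) T) := 𝔮.map θ with hD
  set I' : Ideal (MvPolynomial (Fin n) κ) := coneIdeal κ I with hI'
  set w : Fin n → κ := fun i => ρ (π (X i)) with hw
  set 𝔪 : Ideal (MvPolynomial (Fin n) κ) := RingHom.ker (eval w) with h𝔪
  obtain ⟨e, heX, -⟩ := exists_ringEquiv_quotient_map_taylor π ρ hπ hkerπ hρ hkerρ hρC
  let Ψ : MvPolynomial (Fin n) T →+* MvPolynomial (Fin n) κ ⧸ I' :=
    (e : (MvPolynomial (Fin n) T ⧸ D) →+* MvPolynomial (Fin n) κ ⧸ I').comp (Ideal.Quotient.mk D)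
  have hΨapply : ∀ x, Ψ x = e (Ideal.Quotient.mk D x) := fun x => rfl
  have hΨsurj : Function.Surjective Ψ := e.surjective.comp Ideal.Quotient.mk_surjective
  have hΨker : RingHom.ker Ψ = D := by
    ext x
    rw [RingHom.mem_ker, hΨapply, e.map_eq_zero_iff, Ideal.Quotient.eq_zero_iff_mem]
  have hΨX : ∀ i, Ψ (X i) = Ideal.Quotient.mk I' (C (w i) - X i) := fun i => heX i
  have hmapZ : (idealOfVars (Fin n) T).map Ψ = 𝔪.map (Ideal.Quotient.mk I') := by
    rw [idealOfVars, Ideal.map_span, h𝔪, ker_eval_eq_span w, Ideal.map_span, ← Set.range_comp,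
      ← Set.range_comp, ← span_range_neg_eq ((Ideal.Quotient.mk I') ∘ fun i => X i - C (w i))]
    congr 1
    refine congrArg Set.range (funext fun i => ?_)
    rw [Function.comp_apply, hΨX i, Function.comp_apply, ← map_neg, neg_sub]
  have hle : I' ≤ I' ⊔ 𝔪 ^ k := le_sup_left
  let Ψk : MvPolynomial (Fin n) T →+* MvPolynomial (Fin n) κ ⧸ (I' ⊔ 𝔪 ^ k) :=
    (Ideal.Quotient.factor hle).comp Ψ
  have hΨk_surj : Function.Surjective Ψk := (Ideal.Quotient.factor_surjective hle).comp hΨsurj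
  have hΨk_ker : RingHom.ker Ψk = D ⊔ idealOfVars (Fin n) T ^ k := by
    refine le_antisymm ?_ (sup_le ?_ ?_)
    · intro x hx
      rw [RingHom.mem_ker, RingHom.comp_apply] at hx
      obtain ⟨y, hy⟩ := Ideal.Quotient.mk_surjective (Ψ x)
      rw [← hy, Ideal.Quotient.factor_mk, Ideal.Quotient.eq_zero_iff_mem] at hx
      have h1 : Ψ x ∈ (𝔪 ^ k).map (Ideal.Quotient.mk I') := by
        rw [← hy, Ideal.mem_quotient_iff_mem_sup, sup_comm]
        exact hx
      rw [Ideal.map_pow, ← hmapZ, ← Ideal.map_pow, ← Ideal.mem_comap,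
        Ideal.comap_map_of_surjective Ψ hΨsurj, ← RingHom.ker_eq_comap_bot, hΨker, sup_comm] at h1
      exact h1
    · intro x hx
      have h0 : Ψ x = 0 := by rw [← RingHom.mem_ker, hΨker]; exact hx
      rw [RingHom.mem_ker, RingHom.comp_apply, h0, map_zero]
    · have h : (idealOfVars (Fin n) T ^ k).map Ψk = ⊥ := by
        rw [Ideal.map_pow, show (idealOfVars (Fin n) T).map Ψk = 𝔪.map (Ideal.Quotient.mk (I' ⊔ 𝔪 ^ k))
          from by rw [← Ideal.map_map, hmapZ, Ideal.map_map, Ideal.Quotient.factor_comp_mk],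
          ← Ideal.map_pow]
        exact (Ideal.map_eq_bot_iff_le_ker _).mpr (by rw [Ideal.mk_ker]; exact le_sup_right)
      exact Ideal.map_le_iff_le_comap.mp h.le
  exact ⟨(Ideal.quotEquivOfEq hΨk_ker.symm).trans (RingHom.quotientKerEquivOfSurjective hΨk_surj)⟩

end Dictionary


section LocalQuotients

variable {J : Ideal (MvPolynomial (Fin n) κ)} {v : Fin n → κ} (hJ : J ≤ RingHom.ker (eval v))

include hJ in
/-- `𝔪_v/(J + 𝔪_v^{d+1})` is a maximal ideal of `κ[Y]/(J + 𝔪_v^{d+1})` (`J ⊆ 𝔪_v`). [folklore] -/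
theorem isMaximal_map_ker_eval_quotient_sup_pow (d : ℕ) :
    ((RingHom.ker (eval v)).map
      (Ideal.Quotient.mk (J ⊔ RingHom.ker (eval v) ^ (d + 1)))).IsMaximal := by
  have h𝔪 : (RingHom.ker (eval v)).IsMaximal :=
    RingHom.ker_isMaximal_of_surjective (eval v) fun c => ⟨C c, eval_C c⟩
  have hE : J ⊔ RingHom.ker (eval v) ^ (d + 1) ≤ RingHom.ker (eval v) :=
    sup_le hJ (Ideal.pow_le_self (Nat.succ_ne_zero d))
  refine (Ideal.map_eq_top_or_isMaximal_of_surjective _ Ideal.Quotient.mk_surjective h𝔪).resolve_left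
    fun htop => h𝔪.ne_top ?_
  have h := Ideal.comap_map_of_surjective (Ideal.Quotient.mk (J ⊔ RingHom.ker (eval v) ^ (d + 1)))
    Ideal.Quotient.mk_surjective (RingHom.ker (eval v))
  rw [htop, Ideal.comap_top, ← RingHom.ker_eq_comap_bot, Ideal.mk_ker, sup_eq_left.mpr hE] at h
  exact h.symm

include hJ in
/-- **`κ[Y]/(J + 𝔪_v^{d+1})` is a local ring** (`J ⊆ 𝔪_v`): its only maximal ideal is `𝔪_v/(J + 𝔪_v^{d+1})`.
[folklore] -/
theorem isLocalRing_quotient_sup_ker_eval_pow (d : ℕ) :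
    IsLocalRing (MvPolynomial (Fin n) κ ⧸ (J ⊔ RingHom.ker (eval v) ^ (d + 1))) := by
  have h𝔪 : (RingHom.ker (eval v)).IsMaximal :=
    RingHom.ker_isMaximal_of_surjective (eval v) fun c => ⟨C c, eval_C c⟩
  refine IsLocalRing.of_unique_max_ideal ⟨(RingHom.ker (eval v)).map (Ideal.Quotient.mk _),
    isMaximal_map_ker_eval_quotient_sup_pow hJ d, fun P hP => ?_⟩
  haveI := hP
  have hP' : (P.comap (Ideal.Quotient.mk (J ⊔ RingHom.ker (eval v) ^ (d + 1)))).IsMaximal :=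
    Ideal.comap_isMaximal_of_surjective _ Ideal.Quotient.mk_surjective
  have hEP : J ⊔ RingHom.ker (eval v) ^ (d + 1) ≤ P.comap (Ideal.Quotient.mk _) := fun x hx => by
    rw [Ideal.mem_comap, Ideal.Quotient.eq_zero_iff_mem.mpr hx]
    exact P.zero_mem
  have h𝔪P : RingHom.ker (eval v) ≤ P.comap (Ideal.Quotient.mk _) :=
    (Ideal.IsPrime.pow_le_iff (Nat.succ_ne_zero d)).mp (le_sup_right.trans hEP)
  rw [← Ideal.map_comap_of_surjective (Ideal.Quotient.mk _) Ideal.Quotient.mk_surjective P,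
    ← h𝔪.eq_of_le hP'.ne_top h𝔪P]

include hJ in
/-- **`κ[Y]/(J + 𝔪_v^{d+1})` is residually rational**: every element is a scalar of `κ` modulo the maximal
ideal. [folklore] -/
theorem exists_sub_algebraMap_mem_quotient_sup_ker_eval_pow (d : ℕ) :
    haveI := isLocalRing_quotient_sup_ker_eval_pow hJ d
    ∀ r : MvPolynomial (Fin n) κ ⧸ (J ⊔ RingHom.ker (eval v) ^ (d + 1)), ∃ c : κ,
      r - algebraMap κ _ c ∈ maximalIdeal _ := by
  haveI := isLocalRing_quotient_sup_ker_eval_pow hJ d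
  intro r
  obtain ⟨y, rfl⟩ := Ideal.Quotient.mk_surjective r
  refine ⟨eval v y, ?_⟩
  rw [IsScalarTower.algebraMap_apply κ (MvPolynomial (Fin n) κ)
      (MvPolynomial (Fin n) κ ⧸ (J ⊔ RingHom.ker (eval v) ^ (d + 1))),
    Ideal.Quotient.algebraMap_eq, MvPolynomial.algebraMap_eq, ← map_sub]
  refine IsLocalRing.le_maximalIdeal (isMaximal_map_ker_eval_quotient_sup_pow hJ d).ne_top
    (Ideal.mem_map_of_mem _ ?_)
  rw [RingHom.mem_ker, map_sub, eval_C, sub_self]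

end LocalQuotients

section Length

variable {I 𝔮 : Ideal (MvPolynomial (Fin n) K)} (hπ : Function.Surjective π) (hkerπ : RingHom.ker π = I)
  (hρ : Function.Surjective ρ) (hkerρ : RingHom.ker (ρ.comp π) = 𝔮)
  (hρC : ∀ c : K, ρ (π (C c)) = algebraMap K κ c)
  [((𝔮.map π).map (C : T →+* MvPolynomial (Fin n) T) ⊔ idealOfVars (Fin n) T).IsMaximal]
  (L : Type u) [CommRing L] [Algebra (MvPolynomial (Fin n) T) L]
  [IsLocalization.AtPrime L ((𝔮.map π).map (C : T →+* MvPolynomial (Fin n) T) ⊔ idealOfVars (Fin n) T)]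

include hπ hkerπ hρ hkerρ hρC in
/-- **`ℓ_L(L/(θ(𝔮) + (Z)^{d+1})L) = dim_κ κ[Y]/(Iκ[Y] + 𝔪_w^{d+1})`**: for `L` a localization of the frame
`T[Z]` at `𝔑 = π(𝔮)T[Z] + (Z)` (a maximal ideal: `T/π(𝔮) = κ`), the lengths on the right of Hironaka's
base-change bound (`length_quotient_pow_frame_le_sum`) are the jet codimensions of the base-changed cone
`C_κ` at its rational point `w` — the Hilbert–Samuel numbers `H⁽¹⁾(𝒪_{C_κ,w})(d)`
(`hilbertSamuelFun_one_localization_cone_eq`). The quotient `T[Z]/(θ(𝔮) + (Z)^{d+1}) ≅ κ[Y]/(Iκ[Y] + 𝔪_w^{d+1})`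
is local Artinian with residue field `κ`, so it is its own localization and its length is its `κ`-dimension.
[cite: CossartJannsenSaito2020, proof of Thm. 3.10 (p. 47)] -/
theorem length_quotient_frame_eq_finrank (d : ℕ) :
    Module.length L (L ⧸ (𝔮.map ((MvPolynomial.map π).comp
        (taylorY K n : MvPolynomial (Fin n) K →+* MvPolynomial (Fin n) (MvPolynomial (Fin n) K))) ⊔
          idealOfVars (Fin n) T ^ (d + 1)).map (algebraMap (MvPolynomial (Fin n) T) L)) =
      finrank κ (MvPolynomial (Fin n) κ ⧸
        (coneIdeal κ I ⊔ RingHom.ker (eval fun i => ρ (π (X i))) ^ (d + 1))) := by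
  set 𝔑 : Ideal (MvPolynomial (Fin n) T) :=
    (𝔮.map π).map (C : T →+* MvPolynomial (Fin n) T) ⊔ idealOfVars (Fin n) T with h𝔑
  set θ : MvPolynomial (Fin n) K →+* MvPolynomial (Fin n) T := (MvPolynomial.map π).comp
      (taylorY K n : MvPolynomial (Fin n) K →+* MvPolynomial (Fin n) (MvPolynomial (Fin n) K)) with hθ
  set E : Ideal (MvPolynomial (Fin n) T) := 𝔮.map θ ⊔ idealOfVars (Fin n) T ^ (d + 1) with hE
  set w : Fin n → κ := fun i => ρ (π (X i)) with hw
  set Q := MvPolynomial (Fin n) κ ⧸ (coneIdeal κ I ⊔ RingHom.ker (eval w) ^ (d + 1))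
  have h𝔑max : 𝔑.IsMaximal := inferInstance
  obtain ⟨ek⟩ := nonempty_ringEquiv_quotient_map_taylor_sup_pow π ρ hπ hkerπ hρ hkerρ hρC (d + 1)
  have hI𝔪 : coneIdeal κ I ≤ RingHom.ker (eval w) := coneIdeal_le_ker_eval_frame_point π ρ hkerπ hρC
  haveI : IsLocalRing Q := isLocalRing_quotient_sup_ker_eval_pow hI𝔪 d
  have hE𝔑 : E ≤ 𝔑 := by
    rw [hE, h𝔑, ← map_taylor_sup_idealOfVars π 𝔮]
    exact sup_le le_sup_left ((Ideal.pow_le_self (Nat.succ_ne_zero d)).trans le_sup_right)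
  have hEtop : E ≠ ⊤ := fun h => h𝔑max.ne_top (top_le_iff.mp (h ▸ hE𝔑))
  haveI : Nontrivial (MvPolynomial (Fin n) T ⧸ E) := Ideal.Quotient.nontrivial_iff.mpr hEtop
  haveI : IsLocalRing (MvPolynomial (Fin n) T ⧸ E) :=
    IsLocalRing.of_surjective' (ek.symm : Q →+* MvPolynomial (Fin n) T ⧸ E) ek.symm.surjective
  have hmax : (𝔑.map (Ideal.Quotient.mk E)).IsMaximal := by
    refine (Ideal.map_eq_top_or_isMaximal_of_surjective _ Ideal.Quotient.mk_surjective h𝔑max).resolve_left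
      fun htop => h𝔑max.ne_top ?_
    have h := Ideal.comap_map_of_surjective (Ideal.Quotient.mk E) Ideal.Quotient.mk_surjective 𝔑
    rw [htop, Ideal.comap_top, ← RingHom.ker_eq_comap_bot, Ideal.mk_ker, sup_eq_left.mpr hE𝔑] at h
    exact h.symm
  have hunits : (𝔑.map (Ideal.Quotient.mk E)).primeCompl ≤ IsUnit.submonoid (MvPolynomial (Fin n) T ⧸ E) := by
    intro x hx
    have hx' : x ∉ 𝔑.map (Ideal.Quotient.mk E) := hx
    rw [IsUnit.mem_submonoid_iff]
    by_contra hnu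
    exact hx' (by rw [eq_maximalIdeal hmax]; exact (mem_maximalIdeal x).mpr (mem_nonunits_iff.mpr hnu))
  haveI := isPrime_map_quotientMk_of_le hE𝔑
  haveI := isLocalization_atPrime_quotient_mapExt_of_le hE𝔑 L
  let eL : (MvPolynomial (Fin n) T ⧸ E) ≃ₐ[MvPolynomial (Fin n) T ⧸ E]
      (L ⧸ E.map (algebraMap (MvPolynomial (Fin n) T) L)) :=
    IsLocalization.atUnits (MvPolynomial (Fin n) T ⧸ E) (𝔑.map (Ideal.Quotient.mk E)).primeCompl hunits
  haveI : Module.Finite κ Q := finite_quotient_sup_ker_eval_pow (coneIdeal κ I) w d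
  have hres := exists_sub_algebraMap_mem_quotient_sup_ker_eval_pow hI𝔪 d
  -- isomorphic rings have the same length over themselves (cf. `…CyclesEquivalencesFlatPullbackProofs`)
  have hlen : ∀ {A B : Type u} [CommRing A] [CommRing B] (e : A ≃+* B),
      Module.length A A = Module.length B B := fun e => by
    apply WithBot.coe_injective
    rw [Module.coe_length, Module.coe_length]
    exact (Order.krullDim_eq_of_orderIso e.idealComapOrderIso).symm
  calc Module.length L (L ⧸ E.map (algebraMap (MvPolynomial (Fin n) T) L))
      = Module.length (L ⧸ E.map (algebraMap (MvPolynomial (Fin n) T) L))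
          (L ⧸ E.map (algebraMap (MvPolynomial (Fin n) T) L)) :=
        Module.length_eq_of_surjective (S := L) (R := L ⧸ E.map (algebraMap (MvPolynomial (Fin n) T) L))
          (M := L ⧸ E.map (algebraMap (MvPolynomial (Fin n) T) L))
          (by rw [Ideal.Quotient.algebraMap_eq]; exact Ideal.Quotient.mk_surjective)
    _ = Module.length (MvPolynomial (Fin n) T ⧸ E) (MvPolynomial (Fin n) T ⧸ E) :=
        (hlen eL.toRingEquiv).symm
    _ = Module.length Q Q := hlen ek
    _ = finrank κ Q := Literature.RingTheory.Length.length_eq_finrank_of_residueField hres Q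

end Length

end CampaignW42

end Summit.ResolutionOfSingularities.ResolutionOfSingularities.Theorems
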